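import Summits.QuantumFields.QCD.Theses.NestedDissectionSea

/-!
# Stub `stub_concentration` of line `mass-wegner-cell-index`
(crux `Summit.QuantumFields.QCD.Theses.NestedDissectionSea.NegativeCellsDilute`, item stmt-QuantumFields-13900)

**Abstract second-moment concentration step of the parity pin.**  On a probability space let
`σ = ±1` be a sign, and let `m_b ∈ [0, 1]` (`b : Fin K`, `K ≥ 1`) be flip propensities that are
orthogonal to the sign (`E[σ m_b] = 0`), have means `μ_b = E[m_b] ≥ p₀ > 0` and relative pair
covariances `E[m_b m_b'] - μ_b μ_b' ≤ θ μ_b μ_b'` (`b ≠ b'`).  If `1/(K p₀) + θ ≤ 1/4` then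
`P[σ = -1] ≥ 1/4`.

Proof.  Put `S = Σ_b m_b`, `M = E[S] = Σ_b μ_b ≥ K p₀ > 0`.  Orthogonality gives `E[σ S] = 0`; with
`t = M · E[σ]` and `σ² = 1` pointwise,
`0 ≤ E[((M - S) - t σ)²] = E[S²] - M² - t²`, while
`E[S²] = Σ_{b,b'} E[m_b m_b'] ≤ Σ_b μ_b + (1 + θ) Σ_{b,b'} μ_b μ_b' = M + (1 + θ) M²`
(`m_b² ≤ m_b`).  Hence `M² E[σ]² ≤ θ M² + M`, i.e. `E[σ]² ≤ θ + 1/M ≤ θ + 1/(K p₀) ≤ 1/4`, so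
`E[σ] ≤ 1/2`, and `P[σ = -1] = (1 - E[σ])/2 ≥ 1/4`.  Mathlib only.
-/

noncomputable section

namespace Summit.QuantumFields.QCD.Cruxes.NegativeCellsDilute.MassWegnerCellIndex

open scoped BigOperators ENNReal Classical
open MeasureTheory Filter
open Literature.MathematicalPhysics.QuantumLattice Literature.MathematicalPhysics.QuantumFieldTheory
  Literature.Probability.LatticeModels

/-- A measurable real function bounded in absolute value is integrable against a probability
measure. -/
private theorem concentration_integrable_of_abs_le {Ω : Type} [MeasurableSpace Ω]
    (P : Measure Ω) [IsProbabilityMeasure P] {f : Ω → ℝ} (hf : Measurable f) (C : ℝ)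
    (hC : ∀ ω, |f ω| ≤ C) : Integrable f P :=
  Integrable.of_bound hf.aestronglyMeasurable C
    (Eventually.of_forall fun ω => by simpa only [Real.norm_eq_abs] using hC ω)

/-- Double-sum bookkeeping: `Σ_{b,b'} ((1+θ) μ_b μ_b' + [b = b'] μ_b) = (1+θ) (Σ μ)² + Σ μ`. -/
private theorem concentration_double_sum {K : ℕ} (μ : Fin K → ℝ) (θ : ℝ) :
    ∑ b, ∑ b', ((1 + θ) * (μ b * μ b') + if b = b' then μ b else 0) =
      (1 + θ) * (∑ b, μ b) ^ 2 + ∑ b, μ b := by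
  have inner : ∀ b, ∑ b', ((1 + θ) * (μ b * μ b') + if b = b' then μ b else 0) =
      (1 + θ) * (μ b * ∑ b', μ b') + μ b := by
    intro b
    rw [Finset.sum_add_distrib, Finset.sum_ite_eq, if_pos (Finset.mem_univ _), ← Finset.mul_sum,
      ← Finset.mul_sum]
  rw [Finset.sum_congr rfl (fun b _ => inner b), Finset.sum_add_distrib, ← Finset.mul_sum,
    ← Finset.sum_mul, sq]

/-- **Stub — `concentration`.**  Abstract second-moment concentration: a sign `σ = ±1` orthogonal
to `K` propensities `m_b ∈ [0,1]` with means `≥ p₀` and relative pair covariances `≤ θ` satisfies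
`P[σ = -1] ≥ 1/4` as soon as `1/(K p₀) + θ ≤ 1/4`. -/
theorem stub_concentration :
    ∀ (Ω : Type) [MeasurableSpace Ω] (P : Measure Ω) [IsProbabilityMeasure P] (K : ℕ)
      (σ : Ω → ℝ) (mb : Fin K → Ω → ℝ) (p₀ θ : ℝ),
      0 < K → Measurable σ → (∀ ω, σ ω = 1 ∨ σ ω = -1) →
      (∀ b, Measurable (mb b)) → (∀ b ω, 0 ≤ mb b ω ∧ mb b ω ≤ 1) →
      (∀ b, ∫ ω, σ ω * mb b ω ∂P = 0) →
      0 < p₀ → (∀ b, p₀ ≤ ∫ ω, mb b ω ∂P) → 0 ≤ θ →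
      (∀ b b', b ≠ b' →
        ∫ ω, mb b ω * mb b' ω ∂P - (∫ ω, mb b ω ∂P) * (∫ ω, mb b' ω ∂P) ≤
          θ * ((∫ ω, mb b ω ∂P) * ∫ ω, mb b' ω ∂P)) →
      1 / ((K : ℝ) * p₀) + θ ≤ 1 / 4 →
      (1 / 4 : ℝ) ≤ (P {ω | σ ω = -1}).toReal := by
  intro Ω _ P _ K σ mb p₀ θ hK hσm hσ1 hmbm hmb01 horth hp₀ hfloor hθ hmix hsmall
  -- pointwise facts about the sign
  have hσsq : ∀ ω, σ ω * σ ω = 1 := fun ω => by rcases hσ1 ω with h | h <;> simp [h]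
  have hσabs : ∀ ω, |σ ω| ≤ 1 := fun ω => by rcases hσ1 ω with h | h <;> simp [h]
  -- integrability of all the bounded integrands
  have hσi : Integrable σ P := concentration_integrable_of_abs_le P hσm 1 hσabs
  have hmbi : ∀ b, Integrable (mb b) P := fun b =>
    concentration_integrable_of_abs_le P (hmbm b) 1 fun ω => by
      rw [abs_of_nonneg (hmb01 b ω).1]; exact (hmb01 b ω).2
  have hσmbi : ∀ b, Integrable (fun ω => σ ω * mb b ω) P := fun b =>
    concentration_integrable_of_abs_le P (hσm.mul (hmbm b)) 1 fun ω => by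
      rw [abs_mul, abs_of_nonneg (hmb01 b ω).1]
      exact mul_le_one₀ (hσabs ω) (hmb01 b ω).1 (hmb01 b ω).2
  have hmmi : ∀ b b', Integrable (fun ω => mb b ω * mb b' ω) P := fun b b' =>
    concentration_integrable_of_abs_le P ((hmbm b).mul (hmbm b')) 1 fun ω => by
      rw [abs_mul, abs_of_nonneg (hmb01 b ω).1, abs_of_nonneg (hmb01 b' ω).1]
      exact mul_le_one₀ (hmb01 b ω).2 (hmb01 b' ω).1 (hmb01 b' ω).2
  -- the block sum `S` and its mean `M`
  set S : Ω → ℝ := fun ω => ∑ b, mb b ω with hS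
  set M : ℝ := ∑ b, ∫ ω, mb b ω ∂P with hM
  have hSi : Integrable S P := by
    simp only [hS]; exact integrable_finsetSum _ fun b _ => hmbi b
  have hS_int : ∫ ω, S ω ∂P = M := by
    simp only [hS, hM]; exact integral_finsetSum _ fun b _ => hmbi b
  have hσS_int : ∫ ω, σ ω * S ω ∂P = 0 := by
    simp only [hS, Finset.mul_sum]
    rw [integral_finsetSum _ fun b _ => hσmbi b]
    exact Finset.sum_eq_zero fun b _ => horth b
  have hσSi : Integrable (fun ω => σ ω * S ω) P := by
    simp only [hS, Finset.mul_sum]; exact integrable_finsetSum _ fun b _ => hσmbi b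
  have hSSi : Integrable (fun ω => S ω * S ω) P := by
    simp only [hS, Finset.sum_mul_sum]
    exact integrable_finsetSum _ fun b _ => integrable_finsetSum _ fun b' _ => hmmi b b'
  -- the floor: `K p₀ ≤ M`, so `M > 0`
  have hKp : (K : ℝ) * p₀ ≤ M := by
    have h : ∑ _b : Fin K, p₀ ≤ ∑ b, ∫ ω, mb b ω ∂P := Finset.sum_le_sum fun b _ => hfloor b
    simpa [hM] using h
  have hKp₀ : 0 < (K : ℝ) * p₀ := mul_pos (Nat.cast_pos.mpr hK) hp₀
  have hMpos : 0 < M := lt_of_lt_of_le hKp₀ hKp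
  -- second moment of `S`: `E[S²] ≤ (1 + θ) M² + M`
  have hSS_le : ∫ ω, S ω * S ω ∂P ≤ (1 + θ) * M ^ 2 + M := by
    have h1 : ∫ ω, S ω * S ω ∂P = ∑ b, ∑ b', ∫ ω, mb b ω * mb b' ω ∂P := by
      simp only [hS, Finset.sum_mul_sum]
      rw [integral_finsetSum _ fun b _ => integrable_finsetSum _ fun b' _ => hmmi b b']
      exact Finset.sum_congr rfl fun b _ => integral_finsetSum _ fun b' _ => hmmi b b'
    have h2 : ∀ b b', ∫ ω, mb b ω * mb b' ω ∂P ≤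
        (1 + θ) * ((∫ ω, mb b ω ∂P) * ∫ ω, mb b' ω ∂P) +
          if b = b' then ∫ ω, mb b ω ∂P else 0 := by
      intro b b'
      have hμnn : 0 ≤ ∫ ω, mb b ω ∂P := integral_nonneg fun ω => (hmb01 b ω).1
      by_cases hbb : b = b'
      · subst hbb
        rw [if_pos rfl]
        have hdiag : ∫ ω, mb b ω * mb b ω ∂P ≤ ∫ ω, mb b ω ∂P :=
          integral_mono (hmmi b b) (hmbi b) fun ω =>
            mul_le_of_le_one_right (hmb01 b ω).1 (hmb01 b ω).2
        nlinarith [mul_nonneg hμnn hμnn, mul_nonneg hθ (mul_nonneg hμnn hμnn)]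
      · rw [if_neg hbb, add_zero]
        have := hmix b b' hbb
        linarith
    calc ∫ ω, S ω * S ω ∂P = ∑ b, ∑ b', ∫ ω, mb b ω * mb b' ω ∂P := h1
      _ ≤ ∑ b, ∑ b', ((1 + θ) * ((∫ ω, mb b ω ∂P) * ∫ ω, mb b' ω ∂P) +
            if b = b' then ∫ ω, mb b ω ∂P else 0) :=
          Finset.sum_le_sum fun b _ => Finset.sum_le_sum fun b' _ => h2 b b'
      _ = (1 + θ) * M ^ 2 + M := by
          rw [concentration_double_sum (fun b => ∫ ω, mb b ω ∂P) θ]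
  -- Cauchy–Schwarz / variance step: with `t = M · E[σ]`,
  -- `0 ≤ E[((M - S) - t σ)²] = E[S²] - M² - t²`.
  set x : ℝ := ∫ ω, σ ω ∂P with hx
  set t : ℝ := M * x with ht
  have hexp : ∀ ω, ((M - S ω) - t * σ ω) ^ 2 =
      S ω * S ω + 2 * t * (σ ω * S ω) + (-2 * M) * S ω + (-2 * t * M) * σ ω +
        (M ^ 2 + t ^ 2) := by
    intro ω; linear_combination t ^ 2 * hσsq ω
  have h0 : 0 ≤ ∫ ω, ((M - S ω) - t * σ ω) ^ 2 ∂P := integral_nonneg fun ω => sq_nonneg _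
  have hquad : ∫ ω, ((M - S ω) - t * σ ω) ^ 2 ∂P = ∫ ω, S ω * S ω ∂P - M ^ 2 - t ^ 2 := by
    have iB : Integrable (fun ω => 2 * t * (σ ω * S ω)) P := hσSi.const_mul _
    have iC : Integrable (fun ω => (-2 * M) * S ω) P := hSi.const_mul _
    have iD : Integrable (fun ω => (-2 * t * M) * σ ω) P := hσi.const_mul _
    have iE : Integrable (fun _ : Ω => M ^ 2 + t ^ 2) P := integrable_const _
    simp_rw [hexp]
    rw [integral_add ((hSSi.fun_add iB).fun_add iC |>.fun_add iD) iE,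
      integral_add ((hSSi.fun_add iB).fun_add iC) iD, integral_add (hSSi.fun_add iB) iC,
      integral_add hSSi iB, integral_const_mul, integral_const_mul, integral_const_mul, hσS_int,
      hS_int, integral_const, probReal_univ, one_smul, ← hx, ht]
    ring
  have hkey : M ^ 2 * x ^ 2 ≤ M ^ 2 * (θ + 1 / ((K : ℝ) * p₀)) := by
    have h3 : M ^ 2 * x ^ 2 ≤ θ * M ^ 2 + M := by
      rw [hquad] at h0; rw [ht] at h0; nlinarith [h0, hSS_le]
    have h4 : M ≤ M ^ 2 * (1 / ((K : ℝ) * p₀)) := by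
      have h5 : 1 / M ≤ 1 / ((K : ℝ) * p₀) := one_div_le_one_div_of_le hKp₀ hKp
      have h6 : M = M ^ 2 * (1 / M) := by field_simp
      calc M = M ^ 2 * (1 / M) := h6
        _ ≤ M ^ 2 * (1 / ((K : ℝ) * p₀)) := by gcongr
    nlinarith [h3, h4]
  have hx2 : x ^ 2 ≤ 1 / 4 := by
    have := le_of_mul_le_mul_left hkey (by positivity : 0 < M ^ 2)
    linarith
  have hxle : x ≤ 1 / 2 := by nlinarith [hx2]
  -- `P[σ = -1] = (1 - E[σ]) / 2`
  have hA : MeasurableSet (σ ⁻¹' {-1}) := hσm (measurableSet_singleton _)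
  have hind : ∀ ω, (σ ⁻¹' {-1}).indicator (1 : Ω → ℝ) ω = (1 - σ ω) / 2 := by
    intro ω; rcases hσ1 ω with h | h <;> norm_num [Set.indicator_apply, h]
  have hreal : P.real (σ ⁻¹' {-1}) = (1 - x) / 2 := by
    rw [← integral_indicator_one hA]
    simp_rw [hind]
    rw [integral_div, integral_sub (integrable_const _) hσi, integral_const, probReal_univ,
      one_smul]
  show (1 / 4 : ℝ) ≤ P.real (σ ⁻¹' {-1})
  rw [hreal]
  linarith

end Summit.QuantumFields.QCD.Cruxes.NegativeCellsDilute.MassWegnerCellIndex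

end
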